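import Summits.Parity.GeneralizedHardyLittlewood.Theorems.LiouvilleMADEngineToGHLPairsReach

/-!
# Crux `EngineToGHL` (stmt-Parity-14995, route LiouvilleMAD), line `tuple_ladder` (cycle 2), stub `stub_reachDictionary`

The Green–Tao dictionary of a UNIT-SLOPE system `ψᵢ(n) = n + bᵢ` on `ℤ¹` (`d = 1`, all
coefficients `1`) with DISTINCT shifts `bᵢ` and minimal shift `c` (`c ≤ bᵢ` for all `i`, `c = bᵢ₀`
for some `i₀`), over a body `K ⊆ ℝ¹` with section `J = {y | (y) ∈ K}`:

* (1.2) the weighted prime-point sum is the one-dimensional block sum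
  `∑_{m ∈ T} ∏_{h ∈ H} Λ((m + c) + h)` over the integer points
  `T = {m ∈ [-N, N] : m ∈ J, m > -c}` with `H = {bᵢ - c} ⊆ ℕ` (for `m ≤ -c` the factor with
  `bᵢ₀ = c` is `Λ(≤ 0) = 0`; `∏ᵢ` becomes `∏_{h ∈ H}` by injectivity of the shifts);
* (1.4) the archimedean factor is `β_∞ = vol(J ∩ (-c, ∞))` (`∀ i, x + bᵢ > 0 ↔ x > -c`).

This is the general-`t` version of c1's `EngineToGHL.vonMangoldtSum_unitSlopePair` /
`EngineToGHL.archFactor_unitSlopePair` (file `LiouvilleMADEngineToGHLPairsReachTools.lean`).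

* `stub_reachDictionary` — the registered statement.

References: B. Green, T. Tao, *Linear equations in primes*, Ann. of Math. 171 (2010), (1.2), (1.4)
[GreenTao2010].
-/

noncomputable section

namespace Summit.Parity.GeneralizedHardyLittlewood.Theorems.EngineToGHL.TupleLadder

open Finset Filter MeasureTheory Literature.NumberTheory.Sieve
open scoped ArithmeticFunction.vonMangoldt Topology Classical
open Summit.Parity.GeneralizedHardyLittlewood.Cruxes.RelativeDimOne.TranslateAmplification
  (volume_preimage_apply_zero mem_iff_apply_zero_mem_section)

/-- For `-c < m` and `c ≤ b`: `(m + b)⁺ = (m + c)⁺ + (b - c)⁺` in `ℕ`. [folklore] -/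
theorem toNat_add_eq_of_lt {m b c : ℤ} (hcm : -c < m) (hcb : c ≤ b) :
    (m + b).toNat = (m + c).toNat + (b - c).toNat := by
  omega

/-- On shifts `b ≥ c` the map `b ↦ (b - c)⁺` is injective. [folklore] -/
theorem toNat_sub_injective_of_le {b b' c : ℤ} (hb : c ≤ b) (hb' : c ≤ b')
    (h : (b - c).toNat = (b' - c).toNat) : b = b' := by
  omega

/-- The product of the SAME weight `f` over the values `(m + bᵢ)⁺` of a unit-slope system with
distinct shifts `bᵢ ≥ c`, at a point `m > -c`, is the product over the shift set
`H = {(bᵢ - c)⁺}` of `f((m + c)⁺ + h)`. [folklore] -/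
theorem prod_univ_eq_prod_image_shifts {t : ℕ} {R : Type*} [CommMonoid R] (f : ℕ → R)
    (b : Fin t → ℤ) (hinj : Function.Injective b) {c m : ℤ} (hc : ∀ i, c ≤ b i) (hcm : -c < m) :
    ∏ i, f ((m + b i).toNat) =
      ∏ h ∈ Finset.univ.image (fun i => (b i - c).toNat), f ((m + c).toNat + h) := by
  rw [Finset.prod_image]
  · exact Finset.prod_congr rfl fun i _ => by rw [toNat_add_eq_of_lt hcm (hc i)]
  · intro i _ j _ hij
    exact hinj (toNat_sub_injective_of_le (hc i) (hc j) hij)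

/-- Positivity of all the real forms `x + bᵢ` of a unit-slope system with minimal shift `c`
is `x > -c`. [folklore] -/
theorem forall_pos_add_iff {t : ℕ} (b : Fin t → ℤ) {c : ℤ} (hc : ∀ i, c ≤ b i)
    (hex : ∃ i, b i = c) (x : ℝ) : (∀ i, 0 < x + (b i : ℝ)) ↔ -(c : ℝ) < x := by
  constructor
  · intro h
    obtain ⟨i₀, hi₀⟩ := hex
    have h0 := h i₀
    rw [hi₀] at h0
    linarith
  · intro hx i
    have hci : (c : ℝ) ≤ (b i : ℝ) := by exact_mod_cast hc i
    linarith

/-- **The Green–Tao dictionary of a unit-slope system** `ψᵢ(n) = n + bᵢ` (`d = 1`) with distinct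
shifts and minimal shift `c`: (1.2) the weighted prime-point sum over `K` is the block sum
`∑_{m ∈ T} ∏_{h ∈ H} Λ((m + c)⁺ + h)` over the integer points `T` of the section `J` of `K` above
`-c`, `H = {(bᵢ - c)⁺}`; (1.4) `β_∞ = vol(J ∩ (-c, ∞))`.  General-`t` version of
`EngineToGHL.vonMangoldtSum_unitSlopePair` / `EngineToGHL.archFactor_unitSlopePair`.
[cite: GreenTao2010, (1.2) and (1.4)] -/
theorem stub_reachDictionary : ∀ (t : ℕ) (Ψ : Fin t → Literature.NumberTheory.Sieve.AffLinForm 1), (∀ i j, (Ψ i).coeff j = 1) → Function.Injective (fun i => (Ψ i).const) → ∀ c : ℤ, (∀ i, c ≤ (Ψ i).const) → (∃ i, (Ψ i).const = c) → ∀ (K : Set (Fin 1 → ℝ)) (J : Set ℝ), (∀ y : ℝ, y ∈ J ↔ (fun _ : Fin 1 => y) ∈ K) → ∀ (N : ℕ) (T : Finset ℤ), (∀ m : ℤ, m ∈ T ↔ (m ∈ Finset.Icc (-(N : ℤ)) N ∧ (m : ℝ) ∈ J ∧ -c < m)) → Literature.NumberTheory.Sieve.vonMangoldtSum Ψ K N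 = (∑ m ∈ T, ∏ h ∈ Finset.univ.image (fun i => ((Ψ i).const - c).toNat), ArithmeticFunction.vonMangoldt ((m + c).toNat + h)) ∧ Literature.NumberTheory.Sieve.archFactor Ψ K = (MeasureTheory.volume (J ∩ Set.Ioi (-(c : ℝ)))).toReal := by
  intro t Ψ hcoeff hinj c hc hex K J hJ N T hT
  refine ⟨?_, ?_⟩
  · -- (1.2): pass to the single coordinate `m = n 0`, drop the points `m ≤ -c`, regroup `∏ᵢ`
    obtain ⟨i₀, hi₀⟩ := hex
    unfold vonMangoldtSum latticeBox
    rw [sum_filter_piFinset_const_fin_one]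
    symm
    calc ∑ m ∈ T, ∏ h ∈ Finset.univ.image (fun i => ((Ψ i).const - c).toNat),
          Λ ((m + c).toNat + h)
        = ∑ m ∈ T, ∏ i, Λ ((m + (Ψ i).const).toNat) := by
          refine Finset.sum_congr rfl fun m hm => ?_
          exact (prod_univ_eq_prod_image_shifts (fun n : ℕ => (Λ n : ℝ)) (fun i => (Ψ i).const)
            hinj hc ((hT m).mp hm).2.2).symm
      _ = ∑ m ∈ (Finset.Icc (-(N : ℤ)) N).filter
            (fun m : ℤ => realPoint (fun _ : Fin 1 => m) ∈ K), ∏ i, Λ ((m + (Ψ i).const).toNat) := by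
          refine Finset.sum_subset ?_ ?_
          · intro m hm
            have h := (hT m).mp hm
            exact Finset.mem_filter.mpr ⟨h.1, (hJ (m : ℝ)).mp h.2.1⟩
          · intro m hm hmT
            rw [Finset.mem_filter] at hm
            have hmJ : (m : ℝ) ∈ J := (hJ (m : ℝ)).mpr hm.2
            have hle : ¬ (-c < m) := fun hlt => hmT ((hT m).mpr ⟨hm.1, hmJ, hlt⟩)
            refine Finset.prod_eq_zero (Finset.mem_univ i₀) ?_
            have h0 : (m + (Ψ i₀).const).toNat = 0 := by rw [hi₀]; omega
            rw [h0, ArithmeticFunction.map_zero]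
      _ = _ := by
          refine Finset.sum_congr rfl fun m _ => Finset.prod_congr rfl fun i _ => ?_
          rw [intVonMangoldt, eval_unitSlope (hcoeff i)]
  · -- (1.4): `{x ∈ K | ∀ i, x 0 + bᵢ > 0}` is the preimage of `J ∩ (-c, ∞)` under `x ↦ x 0`
    unfold archFactor
    rw [← volume_preimage_apply_zero]
    congr 2
    ext x
    have hx : x ∈ K ↔ x 0 ∈ J := by
      rw [mem_iff_apply_zero_mem_section K x, Set.mem_setOf_eq, hJ]
    have hre : ∀ i, (Ψ i).realEval x = x 0 + ((Ψ i).const : ℝ) := fun i =>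
      realEval_unitSlope (hcoeff i) x
    simp only [Set.mem_inter_iff, Set.mem_preimage, Set.mem_setOf_eq, Set.mem_Ioi, hre, hx,
      forall_pos_add_iff (fun i => (Ψ i).const) hc hex (x 0)]

end Summit.Parity.GeneralizedHardyLittlewood.Theorems.EngineToGHL.TupleLadder

end
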